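import Mathlib.Analysis.InnerProductSpace.PiL2
import Mathlib.NumberTheory.Real.Irrational
import HarnessLib

/-!
# Ten-point `{0, cos 72°, cos 144°}`-codes in `ℝ⁴`: partner counts and the `144°`-walk (part 1 of the uniqueness proof)

Framing: lottery ticket; floor = certified bounds/negative ranges. Venture `PackingBounds` (cell
`pub-packcert`, seat `pub-packcert-energy` gen 14) — uniqueness infrastructure for the ground states of the
`(1+t)^4` / `(1+t)^5` energies of ten points on `S³` (`Energy.TenPointCkFour/Five`: the kernel-checked rigidity
theorems give the inner-product values `{0, (√5-1)/4, -(√5+1)/4}` and `Σ x = 0`).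

Let `C` be unit vectors of `ℝ⁴` with pairwise inner products in `{0, c₁, c₂}`, `c₁ = cos 72° = (√5-1)/4`,
`c₂ = cos 144° = -(√5+1)/4`, and `Σ_{y ∈ C} ⟪x, y⟫ = 0` for every `x ∈ C` (`IsCode C`). This file proves:
* every point has exactly two partners at `c₂` and two at `c₁`: `1 + c₁ n₁ + c₂ n₂ = 0` forces `n₁ = n₂ = 2` by the
  irrationality of `√5` (`deg_eq_two`); hence a third partner at the same value is impossible (`partner_eq`);
* if `⟪u,v⟫ = ⟪u,w⟫ = c₂` then `‖w - (2c₂ u - v)‖² = 2(⟪v,w⟫ - c₁)`, so `w = 2c₂ u - v` (`third_point`, `step_mem`):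
  the `c₂`-partners propagate by the rotation recurrence `p_{k+2} = 2c₂ p_{k+1} - p_k` (`wk`), whose five points have
  the Gram matrix `gv` of a regular pentagon (`inner_wk`, 25 entries reduced with `(√5)² = 5`) and which closes up
  (`wk_close_four`, `wk_close_zero`).
The structure/uniqueness theorem is in `OrthogonalPentagonsUnique`.
-/

noncomputable section

namespace Summit.Ventures.PackingBounds.Config.OrthogonalPentagonsUnique

open Finset
open scoped RealInnerProductSpace

/-- The ambient space `ℝ⁴`. -/
abbrev E4 := EuclideanSpace ℝ (Fin 4)

/-- `c₁ = cos 72° = (√5 - 1)/4`. -/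
def cone : ℝ := (-1 + Real.sqrt 5) / 4

/-- `c₂ = cos 144° = -(√5 + 1)/4`. -/
def ctwo : ℝ := (-1 - Real.sqrt 5) / 4

/-- `(√5)² = 5`. -/
private theorem hX : Real.sqrt 5 ^ 2 = 5 := Real.sq_sqrt (by norm_num)

/-- `2.236 < √5`. -/
private theorem hlo : (2.236 : ℝ) < Real.sqrt 5 := (Real.lt_sqrt (by norm_num)).mpr (by norm_num)

/-- `√5 < 2.2361`. -/
private theorem hhi : Real.sqrt 5 < 2.2361 := (Real.sqrt_lt' (by norm_num)).mpr (by norm_num)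

/-- `0 < c₁`. -/
theorem cone_pos : 0 < cone := by unfold cone; linarith [hlo]

/-- `c₂ < 0`. -/
theorem ctwo_neg : ctwo < 0 := by unfold ctwo; linarith [hlo]

/-- `c₁ ≠ c₂`. -/
theorem cone_ne_ctwo : cone ≠ ctwo := (lt_trans ctwo_neg cone_pos).ne'

/-- `c₁ < 1`. -/
theorem cone_lt_one : cone < 1 := by unfold cone; linarith [hhi]

/-- `2c₂² - 1 = c₁` (`cos 288° = cos 72°`). -/
theorem two_ctwo_sq : 2 * ctwo * ctwo - 1 = cone := by
  unfold ctwo cone; linear_combination (1 / 8 : ℝ) * hX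

/-- `2c₂c₁ - c₂ = c₁` (`cos 432° = cos 72°`). -/
theorem two_ctwo_cone_sub_ctwo : 2 * ctwo * cone - ctwo = cone := by
  unfold ctwo cone; linear_combination (-1 / 8 : ℝ) * hX

/-- `2c₂c₁ - c₁ = c₂` (`cos 576° = cos 144°`). -/
theorem two_ctwo_cone_sub_cone : 2 * ctwo * cone - cone = ctwo := by
  unfold ctwo cone; linear_combination (-1 / 8 : ℝ) * hX

/-- `2c₂² - c₁ = 1` (the walk closes after five steps). -/
theorem two_ctwo_sq_sub_cone : 2 * ctwo * ctwo - cone = 1 := by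
  unfold ctwo cone; linear_combination (1 / 8 : ℝ) * hX

/-- The hypotheses on a configuration: unit vectors, inner products in `{0, c₁, c₂}`, every row sum of the Gram
matrix vanishes (equivalently `Σ x = 0`). -/
def IsCode (C : Finset E4) : Prop :=
  (∀ x ∈ C, ‖x‖ = 1) ∧ (∀ x ∈ C, ∀ y ∈ C, x ≠ y → inner ℝ x y = 0 ∨ inner ℝ x y = cone ∨ inner ℝ x y = ctwo) ∧
    (∀ x ∈ C, ∑ y ∈ C, inner ℝ x y = 0)

/-- Unit vectors. -/
theorem IsCode.norm_one {C : Finset E4} (h : IsCode C) : ∀ x ∈ C, ‖x‖ = 1 := h.1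

/-- Inner products of distinct points lie in `{0, c₁, c₂}`. -/
theorem IsCode.vals {C : Finset E4} (h : IsCode C) :
    ∀ x ∈ C, ∀ y ∈ C, x ≠ y → inner ℝ x y = 0 ∨ inner ℝ x y = cone ∨ inner ℝ x y = ctwo := h.2.1

/-- Vanishing Gram row sums. -/
theorem IsCode.rowsum {C : Finset E4} (h : IsCode C) : ∀ x ∈ C, ∑ y ∈ C, inner ℝ x y = 0 := h.2.2

/-- `Σ x = 0` gives vanishing Gram row sums. -/
theorem rowsum_of_sum_eq_zero (C : Finset E4) (h : ∑ x ∈ C, x = 0) : ∀ x ∈ C, ∑ y ∈ C, inner ℝ x y = 0 := by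
  intro x _
  rw [← inner_sum, h, inner_zero_right]

variable {C : Finset E4}

/-- The number of partners of `x` at inner product `c`. -/
def deg (C : Finset E4) (x : E4) (c : ℝ) : ℕ := ((C.erase x).filter fun y => inner ℝ x y = c).card

/-- Row sum over the other points: `Σ_{y ≠ x} ⟪x,y⟫ = c₁ · deg c₁ + c₂ · deg c₂`. -/
theorem sum_erase_eq (hC : IsCode C) {x : E4} (hx : x ∈ C) :
    ∑ y ∈ C.erase x, inner ℝ x y = cone * (deg C x cone : ℝ) + ctwo * (deg C x ctwo : ℝ) := by
  classical
  have hsplit : ∀ y ∈ C.erase x, inner ℝ x y =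
      (if inner ℝ x y = cone then cone else 0) + (if inner ℝ x y = ctwo then ctwo else 0) := by
    intro y hy
    have hyC : y ∈ C := Finset.mem_of_mem_erase hy
    have hxy : x ≠ y := fun h => Finset.ne_of_mem_erase hy h.symm
    rcases hC.vals x hx y hyC hxy with h | h | h
    · rw [h, if_neg cone_pos.ne, if_neg ctwo_neg.ne']; ring
    · rw [h, if_pos rfl, if_neg cone_ne_ctwo]; ring
    · rw [h, if_neg cone_ne_ctwo.symm, if_pos rfl]; ring
  rw [Finset.sum_congr rfl hsplit, Finset.sum_add_distrib, ← Finset.sum_filter, ← Finset.sum_filter,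
    Finset.sum_const, Finset.sum_const, nsmul_eq_mul, nsmul_eq_mul, deg, deg]
  ring

/-- **Two partners at `c₂` and two at `c₁`.** From `1 + c₁ n₁ + c₂ n₂ = 0` (row sum) and the irrationality of
`√5`: `n₁ = n₂ = 2`. -/
theorem deg_eq_two (hC : IsCode C) {x : E4} (hx : x ∈ C) : deg C x ctwo = 2 ∧ deg C x cone = 2 := by
  classical
  have hrow := hC.rowsum x hx
  rw [← Finset.add_sum_erase C _ hx, real_inner_self_eq_norm_sq, hC.norm_one x hx, one_pow,
    sum_erase_eq hC hx] at hrow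
  set n₁ := deg C x cone with hn₁
  set n₂ := deg C x ctwo with hn₂
  -- 1 + c₁ n₁ + c₂ n₂ = 0  ⇒  √5 (n₁ - n₂) = n₁ + n₂ - 4
  have hrel : Real.sqrt 5 * ((n₁ : ℝ) - n₂) = (n₁ : ℝ) + n₂ - 4 := by
    unfold cone ctwo at hrow; linarith
  have hirr : Irrational (Real.sqrt 5) := by
    simpa using Nat.Prime.irrational_sqrt Nat.prime_five
  have heq : n₁ = n₂ := by
    by_contra hne
    have hne' : ((n₁ : ℝ) - n₂) ≠ 0 := by
      intro h
      exact hne (by exact_mod_cast (sub_eq_zero.1 h))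
    have hq : Real.sqrt 5 = (((n₁ : ℤ) + n₂ - 4 : ℤ) : ℝ) / (((n₁ : ℤ) - n₂ : ℤ) : ℝ) := by
      rw [eq_div_iff (by push_cast; exact hne')]
      push_cast
      linarith [hrel]
    exact hirr.ne_rational _ _ hq
  rw [heq, sub_self, mul_zero] at hrel
  have h2 : (n₂ : ℝ) = 2 := by linarith
  have h2' : n₂ = 2 := by exact_mod_cast h2
  exact ⟨h2', heq.trans h2'⟩

/-- **The third point is forced.** For unit vectors with `⟪u,v⟫ = ⟪u,w⟫ = c₂` and `⟪v,w⟫ ∈ {0, c₁, c₂}`: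
`w = 2c₂ u - v` (and `⟪v,w⟫ = c₁`), because `‖w - (2c₂u - v)‖² = 2(⟪v,w⟫ - c₁)` and `c₂ < 0 < c₁`. -/
theorem third_point {u v w : E4} (hu : ‖u‖ = 1) (hv : ‖v‖ = 1) (hw : ‖w‖ = 1)
    (huv : inner ℝ u v = ctwo) (huw : inner ℝ u w = ctwo)
    (hvw : inner ℝ v w = 0 ∨ inner ℝ v w = cone ∨ inner ℝ v w = ctwo) :
    w = (2 * ctwo) • u - v := by
  have hvu : inner ℝ v u = ctwo := by rw [real_inner_comm]; exact huv
  have hwu : inner ℝ w u = ctwo := by rw [real_inner_comm]; exact huw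
  have hwv : inner ℝ w v = inner ℝ v w := real_inner_comm _ _
  have huu : inner ℝ u u = 1 := by rw [real_inner_self_eq_norm_sq, hu]; norm_num
  have hvv : inner ℝ v v = 1 := by rw [real_inner_self_eq_norm_sq, hv]; norm_num
  have hww : inner ℝ w w = 1 := by rw [real_inner_self_eq_norm_sq, hw]; norm_num
  have hz : inner ℝ (w - ((2 * ctwo) • u - v)) (w - ((2 * ctwo) • u - v)) = 2 * (inner ℝ v w - cone) := by
    simp only [inner_sub_left, inner_sub_right, inner_smul_left, inner_smul_right, huu, hvv, hww, huv, huw,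
      hvu, hwu, hwv, RCLike.conj_to_real]
    rw [← two_ctwo_sq]
    ring
  have hnn : 0 ≤ inner ℝ (w - ((2 * ctwo) • u - v)) (w - ((2 * ctwo) • u - v)) := real_inner_self_nonneg
  rcases hvw with h | h | h
  · rw [hz, h] at hnn; linarith [cone_pos]
  · rw [h, sub_self, mul_zero] at hz
    have h0 : w - ((2 * ctwo) • u - v) = 0 := inner_self_eq_zero.1 hz
    exact sub_eq_zero.1 h0
  · rw [hz, h] at hnn; linarith [cone_pos, ctwo_neg]

/-- The other `c₂`-partner: if `⟪u,v⟫ = c₂` (`u, v ∈ C`), then `2c₂ u - v ∈ C` with `⟪u, 2c₂u - v⟫ = c₂`. -/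
theorem step_mem (hC : IsCode C) {u v : E4} (hu : u ∈ C) (hv : v ∈ C) (huv : inner ℝ u v = ctwo) :
    (2 * ctwo) • u - v ∈ C ∧ inner ℝ u ((2 * ctwo) • u - v) = ctwo := by
  classical
  have hvu : v ≠ u := by
    intro h; rw [h, real_inner_self_eq_norm_sq, hC.norm_one u hu] at huv
    have := ctwo_neg; norm_num at huv; linarith
  have hvmem : v ∈ (C.erase u).filter fun y => inner ℝ u y = ctwo :=
    Finset.mem_filter.2 ⟨Finset.mem_erase.2 ⟨hvu, hv⟩, huv⟩
  have hcard : 1 < ((C.erase u).filter fun y => inner ℝ u y = ctwo).card := by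
    have := (deg_eq_two hC hu).1; unfold deg at this; omega
  obtain ⟨a, ha, b, hb, hab⟩ := Finset.one_lt_card.1 hcard
  -- one of a, b differs from v
  obtain ⟨w, hw, hwv⟩ : ∃ w ∈ (C.erase u).filter (fun y => inner ℝ u y = ctwo), w ≠ v := by
    by_cases h : a = v
    · exact ⟨b, hb, fun h' => hab (h.trans h'.symm)⟩
    · exact ⟨a, ha, h⟩
  have hwC : w ∈ C := Finset.mem_of_mem_erase (Finset.mem_filter.1 hw).1
  have huw : inner ℝ u w = ctwo := (Finset.mem_filter.1 hw).2
  have hvw := hC.vals v hv w hwC hwv.symm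
  have hform := third_point (hC.norm_one u hu) (hC.norm_one v hv) (hC.norm_one w hwC) huv huw hvw
  rw [← hform]
  exact ⟨hwC, huw⟩

/-- Counting: if `u` has exactly two partners at value `c` and `v ≠ w` are two of them, any partner `y` at value
`c` is `v` or `w`. -/
theorem partner_eq (hC : IsCode C) {u v w y : E4} {c : ℝ} (hc : c ≠ 1) (hu : u ∈ C) (hdeg : deg C u c = 2)
    (hv : v ∈ C) (hw : w ∈ C) (hvw : v ≠ w) (huv : inner ℝ u v = c) (huw : inner ℝ u w = c)
    (hy : y ∈ C) (huy : inner ℝ u y = c) : y = v ∨ y = w := by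
  classical
  have hne1 : ∀ {z}, inner ℝ u z = c → z ≠ u := by
    intro z h heq
    rw [heq, real_inner_self_eq_norm_sq, hC.norm_one u hu] at h
    exact hc (by rw [← h]; norm_num)
  by_contra hcon
  have hyv : y ≠ v := fun h => hcon (Or.inl h)
  have hyw : y ≠ w := fun h => hcon (Or.inr h)
  have hsub : ({v, w, y} : Finset E4) ⊆ (C.erase u).filter fun z => inner ℝ u z = c := by
    intro z hz
    simp only [Finset.mem_insert, Finset.mem_singleton] at hz
    rcases hz with rfl | rfl | rfl
    · exact Finset.mem_filter.2 ⟨Finset.mem_erase.2 ⟨hne1 huv, hv⟩, huv⟩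
    · exact Finset.mem_filter.2 ⟨Finset.mem_erase.2 ⟨hne1 huw, hw⟩, huw⟩
    · exact Finset.mem_filter.2 ⟨Finset.mem_erase.2 ⟨hne1 huy, hy⟩, huy⟩
  have h3 : ({v, w, y} : Finset E4).card = 3 := by
    rw [Finset.card_insert_of_notMem, Finset.card_insert_of_notMem, Finset.card_singleton]
    · simpa using fun h => hyw h.symm
    · simp only [Finset.mem_insert, Finset.mem_singleton, not_or]
      exact ⟨hvw, fun h => hyv h.symm⟩
  unfold deg at hdeg
  have := Finset.card_le_card hsub
  omega

/-! ### The pentagon generated by a `c₂`-pair: explicit walk -/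

/-- The walk `p₀ = x₀`, `p₁ = x₁`, `p_{k+2} = 2c₂ p_{k+1} - p_k` (five points; `0` beyond). -/
def wk (x0 x1 : E4) : ℕ → E4
  | 0 => x0
  | 1 => x1
  | 2 => (2 * ctwo) • x1 - x0
  | 3 => (2 * ctwo) • ((2 * ctwo) • x1 - x0) - x1
  | 4 => (2 * ctwo) • ((2 * ctwo) • ((2 * ctwo) • x1 - x0) - x1) - ((2 * ctwo) • x1 - x0)
  | _ => 0

/-- Gram values of a regular pentagon labelled along the `144°`-walk: `gv i j = cos(144° (i - j))`, `i, j ≤ 4`. -/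
def gv : ℕ → ℕ → ℝ
  | 0, 0 => 1
  | 0, 1 => ctwo
  | 0, 2 => cone
  | 0, 3 => cone
  | 0, 4 => ctwo
  | 1, 0 => ctwo
  | 1, 1 => 1
  | 1, 2 => ctwo
  | 1, 3 => cone
  | 1, 4 => cone
  | 2, 0 => cone
  | 2, 1 => ctwo
  | 2, 2 => 1
  | 2, 3 => ctwo
  | 2, 4 => cone
  | 3, 0 => cone
  | 3, 1 => cone
  | 3, 2 => ctwo
  | 3, 3 => 1
  | 3, 4 => ctwo
  | 4, 0 => ctwo
  | 4, 1 => cone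
  | 4, 2 => cone
  | 4, 3 => ctwo
  | 4, 4 => 1
  | _, _ => 0

section walk
variable {x0 x1 : E4} (h0 : ‖x0‖ = 1) (h1 : ‖x1‖ = 1) (h01 : inner ℝ x0 x1 = ctwo)
include h0 h1 h01

/-- **All inner products of the walk**: `⟪p_i, p_j⟫ = gv i j` for `i, j ≤ 4` (bilinearity from `⟪x₀,x₁⟫ = c₂`,
reduced with `(√5)² = 5`; one `linear_combination` per entry). -/
theorem inner_wk : ∀ i j, i ≤ 4 → j ≤ 4 → inner ℝ (wk x0 x1 i) (wk x0 x1 j) = gv i j := by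
  have e00 : inner ℝ x0 x0 = 1 := by rw [real_inner_self_eq_norm_sq, h0]; norm_num
  have e11 : inner ℝ x1 x1 = 1 := by rw [real_inner_self_eq_norm_sq, h1]; norm_num
  have e10 : inner ℝ x1 x0 = ctwo := by rw [real_inner_comm]; exact h01
  have hX' : Real.sqrt 5 ^ 2 = 5 := Real.sq_sqrt (by norm_num)
  have h3 : Real.sqrt 5 ^ 3 = 5 * Real.sqrt 5 := by
    rw [show Real.sqrt 5 ^ 3 = Real.sqrt 5 ^ 2 * Real.sqrt 5 by ring, hX']
  have h4 : Real.sqrt 5 ^ 4 = 25 := by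
    rw [show Real.sqrt 5 ^ 4 = (Real.sqrt 5 ^ 2) ^ 2 by ring, hX']; norm_num
  have h5 : Real.sqrt 5 ^ 5 = 25 * Real.sqrt 5 := by
    rw [show Real.sqrt 5 ^ 5 = (Real.sqrt 5 ^ 2) ^ 2 * Real.sqrt 5 by ring, hX']; norm_num
  have h6 : Real.sqrt 5 ^ 6 = 125 := by
    rw [show Real.sqrt 5 ^ 6 = (Real.sqrt 5 ^ 2) ^ 3 by ring, hX']; norm_num
  have h7 : Real.sqrt 5 ^ 7 = 125 * Real.sqrt 5 := by
    rw [show Real.sqrt 5 ^ 7 = (Real.sqrt 5 ^ 2) ^ 3 * Real.sqrt 5 by ring, hX']; norm_num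
  intro i j hi hj
  interval_cases i <;> interval_cases j <;>
    simp only [wk, gv, inner_sub_left, inner_sub_right, real_inner_smul_left, real_inner_smul_right,
      e00, e11, e10, h01] <;> (try unfold cone) <;> (try unfold ctwo) <;> ring_nf <;>
    linarith [hX', h3, h4, h5, h6, h7]


/-- The walk closes: `2c₂ p₄ - p₃ = p₀` (zero norm of the difference, from the Gram values). -/
theorem wk_close_four : (2 * ctwo) • wk x0 x1 4 - wk x0 x1 3 = wk x0 x1 0 := by
  have hg := inner_wk h0 h1 h01
  have hX' : Real.sqrt 5 ^ 2 = 5 := Real.sq_sqrt (by norm_num)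
  have hD : inner ℝ ((2 * ctwo) • wk x0 x1 4 - wk x0 x1 3 - wk x0 x1 0)
      ((2 * ctwo) • wk x0 x1 4 - wk x0 x1 3 - wk x0 x1 0) = 0 := by
    simp only [inner_sub_left, inner_sub_right, real_inner_smul_left, real_inner_smul_right,
      hg 4 4 (by norm_num) (by norm_num), hg 4 3 (by norm_num) (by norm_num), hg 4 0 (by norm_num) (by norm_num), hg 3 4 (by norm_num) (by norm_num), hg 3 3 (by norm_num) (by norm_num), hg 3 0 (by norm_num) (by norm_num), hg 0 4 (by norm_num) (by norm_num), hg 0 3 (by norm_num) (by norm_num), hg 0 0 (by norm_num) (by norm_num), gv]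
    unfold ctwo cone
    linear_combination (((-1 : ℝ)/4)) * hX'
  exact sub_eq_zero.1 (inner_self_eq_zero.1 hD)

/-- The walk closes backwards: `2c₂ p₀ - p₁ = p₄`. -/
theorem wk_close_zero : (2 * ctwo) • wk x0 x1 0 - wk x0 x1 1 = wk x0 x1 4 := by
  have hg := inner_wk h0 h1 h01
  have hX' : Real.sqrt 5 ^ 2 = 5 := Real.sq_sqrt (by norm_num)
  have hD : inner ℝ ((2 * ctwo) • wk x0 x1 0 - wk x0 x1 1 - wk x0 x1 4)
      ((2 * ctwo) • wk x0 x1 0 - wk x0 x1 1 - wk x0 x1 4) = 0 := by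
    simp only [inner_sub_left, inner_sub_right, real_inner_smul_left, real_inner_smul_right,
      hg 0 0 (by norm_num) (by norm_num), hg 0 1 (by norm_num) (by norm_num), hg 0 4 (by norm_num) (by norm_num), hg 1 0 (by norm_num) (by norm_num), hg 1 1 (by norm_num) (by norm_num), hg 1 4 (by norm_num) (by norm_num), hg 4 0 (by norm_num) (by norm_num), hg 4 1 (by norm_num) (by norm_num), hg 4 4 (by norm_num) (by norm_num), gv]
    unfold ctwo cone
    linear_combination (((-1 : ℝ)/4)) * hX'
  exact sub_eq_zero.1 (inner_self_eq_zero.1 hD)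

end walk

end Summit.Ventures.PackingBounds.Config.OrthogonalPentagonsUnique
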